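import Mathlib
import Literature.MathematicalPhysics.QuantumFieldTheory.PlaquetteRandomClusterGiantCycles
import Literature.MathematicalPhysics.QuantumFieldTheory.PlaquetteRandomClusterEulerPoincare
import HarnessLib

/-!
# Duality of the plaquette random-cluster model on the torus (Duncan–Schweinhart, CMP 406 (2025),
# Theorem 18 with Theorem 14 / "Lemma 10"), `i = 2`, in the Alexander-dual dictionary — PROVED

Thirteenth file of the transcription of the Fortuin–Kasteleyn-type representation of `q`-state
Potts lattice gauge theory (companions: `PlaquetteRandomCluster` — setting, readings (R1)–(R3) and
the SCOPE caveat: `ℤ_q`/Potts gauge theory only, nothing here bears on the Yang–Mills mass gap or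
on `BalabanLadder.IR`; in the `ym` ladder only the conditional finite-`𝕋⁴` rung `BalabanLadder.UV`
is closed by any route —, `PottsGaugeEdwardsSokal` (`∂ = δᵀ`), `PlaquetteRandomClusterGiantCycles`
(`Cell₃`, `bd₃`, the events `A`/`S`, `dualParam`, the NAMED FACT Theorem 8 whose printed proof
rests on the duality proved here), `PlaquetteRandomClusterEulerPoincare` (Prop. 15, `twoCycles`)).

Source: P. Duncan, B. Schweinhart, *Topological phases in the plaquette random-cluster model and
Potts lattice gauge theory*, Comm. Math. Phys. **406** (2025), arXiv:2207.08339
[DuncanSchweinhart2025] (arXiv loci): §3 (the dual complex `(𝕋^d_N)•`: "each `i`-plaquette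
intersects exactly one `(d-i)`-plaquette of `(𝕋^d_N)•` … the dual complex `P•` [is] the union of all
plaquettes for which the dual plaquette is not included in `ω`"; giant/local cycles
`b_k = rank φ_*`, `a_k = dim ker φ_*`), **Theorem 14** (Alexander duality: `a_k + b_k = 𝐛_k`,
`b_k + b•_k = rank H_k(𝕋^d)` ("Lemma 10 of [duncan2020homological]"), `a_k = a•_{d-k-1}`), §4.3
**Theorem 18** (the balanced model `μ̃(P) ∝ (√q)^{-b_i(P)} p^{η(P)}(1-p)^{|F^i|-η(P)} q^{𝐛_{i-1}(P)}`
satisfies `μ̃_{𝕋,p,q,i}(P) =_d μ̃_{𝕋,p*,q,d-i}(P•)`, `p* = (1-p)q/((1-p)q+p)`; proof: eqs. (4)–(8),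
Prop. 15 and Thm. 14), Corollary 19.

## What is proved, and in which coordinates (read this first)

Cellular Poincaré/Alexander duality identifies the `k`-cochains of the dual torus `(𝕋^d_L)•` with
the `(d-k)`-chains of `𝕋^d_L` (a dual `k`-cell IS a primal `(d-k)`-cell), the dual coboundary
`δ•_k` with the primal boundary `∂_{d-k}` and the dual boundary `∂•_k` with the primal coboundary
`δ_{d-k}`; the open dual cells of `P•(ω•)` are the duals of the CLOSED plaquettes `ωᶜ` (§3). In this
dictionary every quantity in Theorem 18 for `i = 2` is a linear-algebraic functional of the primal
configuration `ω`, and we PROVE Theorem 18 in that form, for every `d` and every coefficient FIELD: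

* primal side: `η = |ω|`, `𝐛₁(P(ω)) = bettiOne F ω`, giant `2`-cycles
  `b₂(ω) = rank(H₂(P(ω)) → H₂(𝕋)) = dim((Z₂(P(ω)) + B₂(𝕋))/B₂(𝕋))` (`giantTwo`);
* dual side, in primal coordinates: `η• = |ωᶜ|`; the dual cocycles
  `Z^{d-3}(P•(ω•)) ≅ W(ω) := {w ∈ C₃(𝕋) : ∂₃w vanishes off ω}` (`dualCocycles`; the dual Betti
  number `𝐛•_{d-3} = dim W(ω) - dim B^{d-3}(𝕋•)` differs from `dim W(ω)` by an `ω`-INDEPENDENT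
  constant, absorbed below in the normalisation); the dual top cycles
  `Z_{d-2}(P•(ω•)) ≅ K(ω) := {ξ ∈ C²(𝕋) : supp ξ ⊆ ωᶜ, δ₂ξ = 0}` (`dualTopCycles`) and the dual giant
  cycles `b•(ω) = dim((K(ω) + B²(𝕋))/B²(𝕋))` (`dualGiant`), `B²(𝕋) = δ₁(C¹)`.

Main results (all PROVED, no named fact):
* `finrank_dualTopCycles` — dual top Betti number `dim K(ω) = |ωᶜ| - rank(∂₃ restricted off ω)`
  (by `δ₂ = ∂₃ᵀ`, as `finrank_twoCycles` in the companion file);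
* `localTwo_add_dualRank`, `dualLocal_add_primalRank` — the two rank identities behind Theorem 14
  eq. (3) (`a₂ = rank ∂₃ - rank(∂₃ off ω)`, `a• = rank δ₁ - rank(δ₁ on ω)`), and the bookkeeping
  `giantTwo_add_localTwo`, `dualGiant_add_dualLocal` (eq. (1)), `finrank_dualCocycles_add`,
  `finrank_twoCycles_add_primalRank`, `primalRank_univ`, `bd₂_bd₃` (`∂∂ = 0`), `pairing₂_bd₃`
  (`∂₃ = δ₂ᵀ`), `delta₂_eq_zero_iff` (`ker δ₂` = closed plaquette functions);
* **`giantTwo_add_dualGiant`** — Theorem 14 eq. (2) / "Lemma 10":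
  `b₂(ω) + b•(ω) = dim H₂(𝕋^d_L; F)` for every `ω`;
* **`duality_balanced_weight`** — **Theorem 18 (`i = 2`)**: for `p ∈ (0,1)`, `q > 0` there is
  `C = C(p,q,d,L) > 0` with, for EVERY configuration `ω`,
  `w_{p,q}(ω) · (√q)^{-b₂(ω)} = C · w•_{p*,q}(ω) · (√q)^{-b•(ω)}`, written cross-multiplied, where
  `w•_{p',q}(ω) = p'^{|ωᶜ|} (1-p')^{|ω|} q^{dim W(ω)}` is the dual plaquette random-cluster weight of
  `P•(ω•)` (up to the constant `q^{-dim B^{d-3}(𝕋•)}`) and `p* = dualParam p q`.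

What is NOT done here: the identification of the abstract dual complex with the CUBICAL complex of
the shifted torus `𝕋^d_L + (½,…,½)` (for `d = 4`: that `w•` is again `PlaquetteRC.weight` on
`Plaquette 4 L` after relabelling cells), i.e. the sign bookkeeping `[σ• : τ•] = ±[τ : σ]` of the
cubical dual cell structure; and the probabilistic consequences (Theorem 8 stays a named fact).
-/

open Finset Module

namespace Literature.MathematicalPhysics.QuantumFieldTheory

namespace PlaquetteRC

open LatticeForm

variable {d L : ℕ}

/-! ### `δ₂` on plaquette functions and `∂₃ = δ₂ᵀ` -/

section DeltaTwo

variable (F : Type*) [Field F]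

/-- Restrict a `3`-cochain to the genuine `3`-cells `(x; i < j < k)`. [cite: DuncanSchweinhart2025, §2.1 (i-plaquettes)] -/
def res₃ (m : Site d L → Fin d → Fin d → Fin d → F) : Cell₃ d L → F :=
  fun c => m c.1 c.2.1.1 c.2.1.2.1 c.2.1.2.2

/-- `ext` commutes with scalars. [cite: DuncanSchweinhart2025, §2.4 (cochains with coefficients in a field)] -/
theorem ext_smul (r : F) (η : Plaquette d L → F) : ext (r • η) = r • ext η := by
  funext x i j
  simp only [Pi.smul_apply, smul_eq_mul]
  unfold LatticeForm.ext
  split_ifs <;> simp [Pi.smul_apply, smul_eq_mul, mul_neg]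

/-- `td₂` commutes with scalars. [cite: DuncanSchweinhart2025, §2.4] -/
theorem td₂_smul (r : F) (ω : Site d L → Fin d → Fin d → F) : td₂ (r • ω) = r • td₂ ω := by
  funext x i j k
  simp only [td₂, Pi.smul_apply, smul_eq_mul]
  ring

/-- `δ₂ : C²(𝕋; F) → C³(𝕋; F)` on functions of the genuine cells: `η ↦ (td₂ (ext η))|_{3-cells}`, as a
linear map. [cite: DuncanSchweinhart2025, §2.4 (the coboundary δ)] -/
def delta₂ : (Plaquette d L → F) →ₗ[F] (Cell₃ d L → F) where
  toFun η := res₃ F (td₂ (ext η))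
  map_add' a b := by
    funext c
    simp only [res₃, ext_add, td₂_add, Pi.add_apply]
  map_smul' r a := by
    funext c
    simp only [res₃, ext_smul, td₂_smul, Pi.smul_apply, smul_eq_mul, RingHom.id_apply]

/-- `delta₂` unfolded. [cite: DuncanSchweinhart2025, §2.4] -/
@[simp] theorem delta₂_apply (η : Plaquette d L → F) (c : Cell₃ d L) :
    delta₂ (d := d) (L := L) F η c = td₂ (ext η) c.1 c.2.1.1 c.2.1.2.1 c.2.1.2.2 := rfl

/-- `ker δ₂` = the closed plaquette functions (`IsClosedPl`, restricted to genuine cells — for an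
alternating extension the two agree). [cite: DuncanSchweinhart2025, §2.4 (Z^i = ker δ)] -/
theorem delta₂_eq_zero_iff (η : Plaquette d L → F) :
    delta₂ (d := d) (L := L) F η = 0 ↔ IsClosedPl η := by
  constructor
  · intro h x i j k
    exact td₂_eq_zero_of_sorted (isAlt_ext η) (fun y a b c hab hbc => by
      have := congrFun h (y, ⟨(a, b, c), hab, hbc⟩)
      simpa using this) x i j k
  · intro h
    funext c
    simpa using h c.1 c.2.1.1 c.2.1.2.1 c.2.1.2.2

variable [NeZero L]

/-- The pairing of functions on `3`-cells. [cite: DuncanSchweinhart2025, §2.4 (cochains as the dual of chains)] -/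
def pairing₃ (m w : Cell₃ d L → F) : F := ∑ c : Cell₃ d L, m c * w c

/-- The boundary `∂₃ : C₃ → C₂` (`bd₃`) as a linear map. [cite: DuncanSchweinhart2025, §2.1 (∂)] -/
def bd₃Lin : (Cell₃ d L → F) →ₗ[F] (Plaquette d L → F) where
  toFun := bd₃
  map_add' a b := by
    funext σ
    simp only [bd₃, Pi.add_apply, add_mul, Finset.sum_add_distrib]
  map_smul' r a := by
    funext σ
    simp only [bd₃, Pi.smul_apply, smul_eq_mul, RingHom.id_apply, Finset.mul_sum, mul_assoc]

/-- `bd₃Lin` is `bd₃`. [cite: DuncanSchweinhart2025, §2.1] -/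
@[simp] theorem bd₃Lin_apply (w : Cell₃ d L → F) : bd₃Lin (d := d) (L := L) F w = bd₃ w := rfl

/-- Expansion of a plaquette function in the cell basis: `η = Σ_σ η(σ) 𝟙_σ`. [cite: DuncanSchweinhart2025, §2.1] -/
theorem sum_smul_plaqInd (η : Plaquette d L → F) :
    (∑ σ : Plaquette d L, η σ • plaqInd (R := F) σ) = η := by
  funext τ
  simp only [Finset.sum_apply, Pi.smul_apply, plaqInd, smul_eq_mul, mul_ite, mul_one, mul_zero]
  rw [Finset.sum_eq_single τ]
  · simp
  · intro σ _ hσ; rw [if_neg (Ne.symm hσ)]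
  · intro h; exact absurd (Finset.mem_univ τ) h

/-- **`∂₃` is the transpose of `δ₂`**: `⟨η, ∂₃w⟩₂ = ⟨δ₂η, w⟩₃`. [cite: DuncanSchweinhart2025, §1.1 Def. 2 (δf(σ) = f(∂σ)) and §2.1] -/
theorem pairing₂_bd₃ (η : Plaquette d L → F) (w : Cell₃ d L → F) :
    pairing₂ η (bd₃ w) = pairing₃ F (delta₂ F η) w := by
  unfold pairing₂ bd₃ pairing₃
  have hlin : ∀ c : Cell₃ d L,
      delta₂ (d := d) (L := L) F η c = ∑ σ : Plaquette d L, η σ * delta₂ (d := d) (L := L) F (plaqInd σ) c := by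
    intro c
    conv_lhs => rw [← sum_smul_plaqInd F η]
    rw [map_sum]
    simp only [Finset.sum_apply, map_smul, Pi.smul_apply, smul_eq_mul]
  simp_rw [hlin, delta₂_apply, Finset.mul_sum, Finset.sum_mul]
  rw [Finset.sum_comm]
  refine Finset.sum_congr rfl fun σ _ => Finset.sum_congr rfl fun c _ => ?_
  ring

/-- `⟨𝟙_c, w⟩₃ = w(c)`. [cite: DuncanSchweinhart2025, §2.4] -/
theorem pairing₃_single_left [DecidableEq (Cell₃ d L)] (c : Cell₃ d L) (w : Cell₃ d L → F) :
    pairing₃ F (fun c' => if c' = c then 1 else 0) w = w c := by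
  unfold pairing₃
  simp only [ite_mul, one_mul, zero_mul, Finset.sum_ite_eq', Finset.mem_univ, if_true]

/-- `δ₂ξ = 0` iff `⟨ξ, ∂₃w⟩ = 0` for all `3`-chains `w` (`∂₃ = δ₂ᵀ`, non-degenerate pairing).
[cite: DuncanSchweinhart2025, §2.4] -/
theorem delta₂_eq_zero_iff_pairing (ξ : Plaquette d L → F) :
    delta₂ (d := d) (L := L) F ξ = 0 ↔ ∀ w : Cell₃ d L → F, pairing₂ ξ (bd₃ w) = 0 := by
  classical
  constructor
  · intro h w
    rw [pairing₂_bd₃, h]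
    unfold pairing₃
    simp
  · intro h
    funext c
    have := h (fun c' => if c' = c then 1 else 0)
    rw [pairing₂_bd₃, pairing₃] at this
    simp only [mul_ite, mul_one, mul_zero, Finset.sum_ite_eq', Finset.mem_univ, if_true] at this
    simpa using this

/-- **`∂₂ ∘ ∂₃ = 0`** (transpose of `td₂ ∘ td₁ = 0`): every `2`-boundary of the torus is a `2`-cycle.
[cite: DuncanSchweinhart2025, §2.1 (∂∂ = 0)] -/
theorem bd₂_bd₃ (w : Cell₃ d L → F) : bd₂ (bd₃ w) = 0 := by
  rw [bd₂_eq_zero_iff]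
  intro θ
  rw [pairing₂_bd₃]
  have h0 : delta₂ (d := d) (L := L) F (res (td₁ θ)) = 0 := by
    funext c
    simp only [delta₂_apply, Pi.zero_apply]
    rw [ext_res (isAlt_td₁ θ), td₂_td₁]
    rfl
  rw [h0]
  unfold pairing₃
  simp

end DeltaTwo

/-! ### A rank identity (the mechanism of Theorem 14, eq. (3)) -/

section RankLemma

variable {F : Type*} [Field F] {V W U : Type*} [AddCommGroup V] [Module F V] [AddCommGroup W]
  [Module F W] [AddCommGroup U] [Module F U] [FiniteDimensional F W]

/-- `dim(range T ∩ ker π) + rank(π ∘ T) = rank T` (rank–nullity for `π` restricted to `range T`).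
Applied with `π` = restriction of cell functions to a set of cells, this is how the local cycles of
one complex are counted by ranks of the other in Alexander duality. [cite: DuncanSchweinhart2025, Thm. 14 (proof: rank–nullity and the long exact sequence)] -/
theorem finrank_range_inf_ker_add_finrank_range_comp (T : V →ₗ[F] W) (π : W →ₗ[F] U) :
    finrank F ↥(LinearMap.range T ⊓ LinearMap.ker π) + finrank F (LinearMap.range (π ∘ₗ T)) =
      finrank F (LinearMap.range T) := by
  have h := LinearMap.finrank_range_add_finrank_ker (π.domRestrict (LinearMap.range T))
  rw [LinearMap.range_domRestrict, LinearMap.ker_domRestrict, ← LinearMap.range_comp] at h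
  have hk : Submodule.comap (LinearMap.range T).subtype (LinearMap.ker π) =
      Submodule.comap (LinearMap.range T).subtype (LinearMap.range T ⊓ LinearMap.ker π) := by
    rw [Submodule.comap_inf, Submodule.comap_subtype_self, top_inf_eq]
  have hfin : finrank F ↥(Submodule.comap (LinearMap.range T).subtype (LinearMap.ker π)) =
      finrank F ↥(LinearMap.range T ⊓ LinearMap.ker π) := by
    rw [hk]
    exact (Submodule.comapSubtypeEquivOfLe (p := LinearMap.range T ⊓ LinearMap.ker π)
      (q := LinearMap.range T) inf_le_left).finrank_eq
  omega

end RankLemma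

/-! ### The cast of Theorem 18 in primal coordinates -/

section Cast

variable (F : Type*) [Field F]

/-- `δ : C¹ → C²` (plaquette field of an edge cochain, on genuine plaquettes) as a linear map.
[cite: DuncanSchweinhart2025, §2.4 (δ)] -/
def delta₁ : (Site d L → Fin d → F) →ₗ[F] (Plaquette d L → F) where
  toFun θ := res (td₁ θ)
  map_add' a b := by funext σ; simp only [res, td₁_add, Pi.add_apply]
  map_smul' r a := by funext σ; simp only [res, td₁_smul, Pi.smul_apply, RingHom.id_apply]

/-- `delta₁` unfolded. [cite: DuncanSchweinhart2025, §2.4] -/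
@[simp] theorem delta₁_apply (θ : Site d L → Fin d → F) : delta₁ (d := d) (L := L) F θ = res (td₁ θ) := rfl

variable [NeZero L]

/-- Functions on cells supported on the set `S`. [cite: DuncanSchweinhart2025, §2.1 (chains of a subcomplex)] -/
def supportedOn {α : Type*} (S : Finset α) : Submodule F (α → F) where
  carrier := {f | ∀ a, a ∉ S → f a = 0}
  add_mem' ha hb := fun a h => by rw [Pi.add_apply, ha a h, hb a h, add_zero]
  zero_mem' := fun _ _ => rfl
  smul_mem' r _ ha := fun a h => by rw [Pi.smul_apply, ha a h, smul_zero]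

/-- Restriction of cell functions to the cells of `S`, as a linear map. [cite: DuncanSchweinhart2025, §2.1] -/
def restrictTo {α : Type*} (S : Finset α) : (α → F) →ₗ[F] (↥S → F) where
  toFun f a := f a.1
  map_add' _ _ := rfl
  map_smul' _ _ := rfl

/-- `ker (restrict to Sᶜ) = functions supported on S`. [cite: DuncanSchweinhart2025, §2.1] -/
theorem ker_restrictTo_compl {α : Type*} [Fintype α] [DecidableEq α] (S : Finset α) :
    LinearMap.ker (restrictTo F Sᶜ) = supportedOn F S := by
  ext f
  simp only [LinearMap.mem_ker, supportedOn, Submodule.mem_mk, AddSubmonoid.mem_mk,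
    AddSubsemigroup.mem_mk, Set.mem_setOf_eq]
  constructor
  · intro h a ha
    have := congrFun h ⟨a, Finset.mem_compl.mpr ha⟩
    simpa [restrictTo] using this
  · intro h
    funext a
    simpa [restrictTo] using h a.1 (Finset.mem_compl.mp a.2)

/-- `δ_ω = (restrict to ω) ∘ δ`. [cite: DuncanSchweinhart2025, §2.4] -/
theorem restrictTo_comp_delta₁ (ω : Finset (Plaquette d L)) :
    restrictTo F ω ∘ₗ delta₁ (d := d) (L := L) F = coboundaryOn F ω := by
  ext θ σ
  rfl

/-- `B²(𝕋) = δ(C¹)`: the plaquette fields of edge cochains (under the dual dictionary: the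
`(d-2)`-boundaries `B_{d-2}(𝕋•)` of the dual torus). [cite: DuncanSchweinhart2025, §2.4 (B^i) and Thm. 14] -/
abbrev cobTwo : Submodule F (Plaquette d L → F) := LinearMap.range (delta₁ (d := d) (L := L) F)

/-- `B₂(𝕋) = ∂₃(C₃)`: the `2`-boundaries of the full torus complex. [cite: DuncanSchweinhart2025, §2.1 (B_i) and §3 (giant vs local cycles)] -/
abbrev bdTwo : Submodule F (Plaquette d L → F) := LinearMap.range (bd₃Lin (d := d) (L := L) F)

/-- **Giant `2`-cycles `b₂(P(ω)) = rank(φ_* : H₂(P(ω)) → H₂(𝕋))`**: `P(ω)` has no `3`-cells, so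
`H₂(P(ω)) = Z₂(P(ω))` and `rank φ_* = dim((Z₂(P(ω)) + B₂(𝕋))/B₂(𝕋)) = dim(Z₂(P(ω)) ⊔ B₂) - dim B₂`.
[cite: DuncanSchweinhart2025, §3 (b_k = rank φ_*) and §4.3 (b_i(P))] -/
noncomputable def giantTwo (ω : Finset (Plaquette d L)) : ℕ :=
  finrank F ↥(twoCycles F ω ⊔ bdTwo (d := d) (L := L) F) - finrank F ↥(bdTwo (d := d) (L := L) F)

/-- Local `2`-cycles `a₂(P(ω)) = dim ker φ_* = dim(Z₂(P(ω)) ∩ B₂(𝕋))`. [cite: DuncanSchweinhart2025, §3 (a_k = dim ker φ_*)] -/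
noncomputable def localTwo (ω : Finset (Plaquette d L)) : ℕ :=
  finrank F ↥(twoCycles F ω ⊓ bdTwo (d := d) (L := L) F)

/-- **Dual cocycles in primal coordinates**: `Z^{d-3}(P•(ω•); F) ≅ W(ω) = {w ∈ C₃(𝕋) : (∂₃w)(σ) = 0
for every CLOSED plaquette σ ∉ ω}` (a dual `(d-3)`-cochain is a primal `3`-chain, `δ•_{d-3} = ∂₃`,
and the open dual `(d-2)`-cells are the duals of the closed plaquettes). [cite: DuncanSchweinhart2025, §3 (P•) and Thm. 14] -/
def dualCocycles (ω : Finset (Plaquette d L)) : Submodule F (Cell₃ d L → F) :=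
  LinearMap.ker (restrictTo F ωᶜ ∘ₗ bd₃Lin (d := d) (L := L) F)

/-- Membership in `W(ω)`. [cite: DuncanSchweinhart2025, §3] -/
theorem mem_dualCocycles {ω : Finset (Plaquette d L)} {w : Cell₃ d L → F} :
    w ∈ dualCocycles F ω ↔ ∀ σ, σ ∉ ω → bd₃ w σ = 0 := by
  unfold dualCocycles
  rw [LinearMap.mem_ker]
  constructor
  · intro h σ hσ
    have := congrFun h ⟨σ, Finset.mem_compl.mpr hσ⟩
    simpa [restrictTo] using this
  · intro h
    funext σ
    simpa [restrictTo] using h σ.1 (Finset.mem_compl.mp σ.2)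

/-- **Dual top cycles in primal coordinates**: `Z_{d-2}(P•(ω•); F) ≅ K(ω) = {ξ ∈ C²(𝕋) :
supp ξ ⊆ ωᶜ, δ₂ξ = 0}` (`∂•_{d-2} = δ₂`; `P•` has no `(d-1)`-cells, so these are also
`H_{d-2}(P•(ω•))`). [cite: DuncanSchweinhart2025, §3 and Thm. 14] -/
def dualTopCycles (ω : Finset (Plaquette d L)) : Submodule F (Plaquette d L → F) :=
  supportedOn F ωᶜ ⊓ LinearMap.ker (delta₂ (d := d) (L := L) F)

/-- Membership in `K(ω)`. [cite: DuncanSchweinhart2025, §3] -/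
theorem mem_dualTopCycles {ω : Finset (Plaquette d L)} {ξ : Plaquette d L → F} :
    ξ ∈ dualTopCycles F ω ↔ (∀ σ, σ ∈ ω → ξ σ = 0) ∧ delta₂ (d := d) (L := L) F ξ = 0 := by
  unfold dualTopCycles supportedOn
  simp only [Submodule.mem_inf, Submodule.mem_mk, AddSubmonoid.mem_mk, AddSubsemigroup.mem_mk,
    Set.mem_setOf_eq, LinearMap.mem_ker, Finset.mem_compl, not_not]

/-- **Dual giant cycles `b•(ω) = rank(ψ_* : H_{d-2}(P•(ω•)) → H_{d-2}(𝕋•))`** in primal coordinates: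
`dim((K(ω) + B²(𝕋))/B²(𝕋))` (`B_{d-2}(𝕋•) = B²(𝕋) = δ(C¹)`). [cite: DuncanSchweinhart2025, §3 (b•_k = rank ψ_*) and Thm. 18 (b•_{d-i})] -/
noncomputable def dualGiant (ω : Finset (Plaquette d L)) : ℕ :=
  finrank F ↥(dualTopCycles F ω ⊔ cobTwo (d := d) (L := L) F) - finrank F ↥(cobTwo (d := d) (L := L) F)

/-- Dual local cycles `a•(ω) = dim(K(ω) ∩ B²(𝕋))`. [cite: DuncanSchweinhart2025, §3 (a•_k)] -/
noncomputable def dualLocal (ω : Finset (Plaquette d L)) : ℕ :=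
  finrank F ↥(dualTopCycles F ω ⊓ cobTwo (d := d) (L := L) F)

/-- `rank(∂₃ restricted to the closed plaquettes)`: the rank `r•(ω)` of `π_{ωᶜ} ∘ ∂₃`.
[cite: DuncanSchweinhart2025, Thm. 14 (proof)] -/
noncomputable def dualRank (ω : Finset (Plaquette d L)) : ℕ :=
  finrank F (LinearMap.range (restrictTo F ωᶜ ∘ₗ bd₃Lin (d := d) (L := L) F))

/-- `rank(δ restricted to the open plaquettes)`: `r(ω) = dim B²(P(ω)) = rank δ_ω`.
[cite: DuncanSchweinhart2025, Thm. 14 (proof)] -/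
noncomputable def primalRank (ω : Finset (Plaquette d L)) : ℕ :=
  finrank F (LinearMap.range (coboundaryOn (d := d) (L := L) F ω))

end Cast

/-! ### The rank identities (Theorem 14) -/

section AlexanderDuality

variable (F : Type*) [Field F] [NeZero L]

/-- `dim W(ω) + r•(ω) = dim C₃(𝕋)` (rank–nullity; `dim W(ω) = dim Z^{d-3}(P•(ω•))`).
[cite: DuncanSchweinhart2025, Thm. 14 eq. (1) (dual side) with Prop. 15] -/
theorem finrank_dualCocycles_add (ω : Finset (Plaquette d L)) :
    finrank F (dualCocycles F ω) + dualRank F ω = Fintype.card (Cell₃ d L) := by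
  unfold dualCocycles dualRank
  have h := LinearMap.finrank_range_add_finrank_ker (restrictTo F ωᶜ ∘ₗ bd₃Lin (d := d) (L := L) F)
  rw [Module.finrank_fintype_fun_eq_card] at h
  omega

/-- **Local primal `2`-cycles are counted by the dual rank (Theorem 14, eq. (3), primal→dual):**
`a₂(ω) + r•(ω) = rank ∂₃ = dim B₂(𝕋)`. Indeed `Z₂(P(ω)) ∩ B₂ = C₂(ω) ∩ B₂ = range ∂₃ ∩ ker π_{ωᶜ}`
(every boundary is a cycle), and `dim(range ∂₃ ∩ ker π_{ωᶜ}) + rank(π_{ωᶜ}∂₃) = rank ∂₃`.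
[cite: DuncanSchweinhart2025, Thm. 14 eq. (3)] -/
theorem localTwo_add_dualRank (ω : Finset (Plaquette d L)) :
    localTwo F ω + dualRank F ω = finrank F ↥(bdTwo (d := d) (L := L) F) := by
  classical
  have key := finrank_range_inf_ker_add_finrank_range_comp (bd₃Lin (d := d) (L := L) F) (restrictTo F ωᶜ)
  have hinf : twoCycles F ω ⊓ bdTwo (d := d) (L := L) F =
      LinearMap.range (bd₃Lin (d := d) (L := L) F) ⊓ LinearMap.ker (restrictTo F ωᶜ) := by
    rw [ker_restrictTo_compl]
    ext z
    simp only [Submodule.mem_inf, mem_twoCycles, supportedOn, Submodule.mem_mk, AddSubmonoid.mem_mk,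
      AddSubsemigroup.mem_mk, Set.mem_setOf_eq]
    constructor
    · rintro ⟨⟨hsupp, -⟩, hB⟩
      exact ⟨hB, hsupp⟩
    · rintro ⟨hB, hsupp⟩
      refine ⟨⟨hsupp, ?_⟩, hB⟩
      obtain ⟨w, rfl⟩ := LinearMap.mem_range.mp hB
      exact bd₂_bd₃ F w
  unfold localTwo dualRank
  rw [hinf]
  exact key

/-- **Local dual cycles are counted by the primal rank (Theorem 14, eq. (3), dual→primal):**
`a•(ω) + r(ω) = rank δ₁ = dim B²(𝕋)`: `K(ω) ∩ B² = C²(ωᶜ) ∩ range δ₁ = range δ₁ ∩ ker π_ω` (every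
coboundary is closed) and `dim(range δ₁ ∩ ker π_ω) + rank(π_ω δ₁) = rank δ₁`, `π_ω δ₁ = δ_ω`.
[cite: DuncanSchweinhart2025, Thm. 14 eq. (3)] -/
theorem dualLocal_add_primalRank (ω : Finset (Plaquette d L)) :
    dualLocal F ω + primalRank F ω = finrank F ↥(cobTwo (d := d) (L := L) F) := by
  classical
  have key := finrank_range_inf_ker_add_finrank_range_comp (delta₁ (d := d) (L := L) F) (restrictTo F ω)
  rw [restrictTo_comp_delta₁] at key
  have hinf : dualTopCycles F ω ⊓ cobTwo (d := d) (L := L) F =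
      LinearMap.range (delta₁ (d := d) (L := L) F) ⊓ LinearMap.ker (restrictTo F ω) := by
    have hk : LinearMap.ker (restrictTo F ω) = supportedOn F (ωᶜ : Finset (Plaquette d L)) := by
      rw [← ker_restrictTo_compl F (ωᶜ : Finset (Plaquette d L)), compl_compl]
    rw [hk]
    ext ξ
    simp only [Submodule.mem_inf, mem_dualTopCycles, supportedOn, Submodule.mem_mk,
      AddSubmonoid.mem_mk, AddSubsemigroup.mem_mk, Set.mem_setOf_eq, Finset.mem_compl, not_not]
    constructor
    · rintro ⟨⟨hsupp, -⟩, hB⟩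
      exact ⟨hB, hsupp⟩
    · rintro ⟨hB, hsupp⟩
      refine ⟨⟨hsupp, ?_⟩, hB⟩
      obtain ⟨θ, rfl⟩ := LinearMap.mem_range.mp hB
      funext c
      simp only [delta₁_apply, delta₂_apply, Pi.zero_apply]
      rw [ext_res (isAlt_td₁ θ), td₂_td₁]
      rfl
  unfold dualLocal primalRank
  rw [hinf]
  exact key

/-- `b₂ + a₂ = 𝐛₂ = dim Z₂(P(ω))` (Theorem 14 eq. (1): rank–nullity for `φ_*`; here the modular
law `dim(U ⊔ W) + dim(U ⊓ W) = dim U + dim W`). [cite: DuncanSchweinhart2025, Thm. 14 eq. (1)] -/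
theorem giantTwo_add_localTwo (ω : Finset (Plaquette d L)) :
    giantTwo F ω + localTwo F ω = finrank F (twoCycles F ω) := by
  have h := Submodule.finrank_sup_add_finrank_inf_eq (twoCycles F ω) (bdTwo (d := d) (L := L) F)
  have hle : finrank F ↥(bdTwo (d := d) (L := L) F) ≤ finrank F ↥(twoCycles F ω ⊔ bdTwo (d := d) (L := L) F) :=
    Submodule.finrank_mono le_sup_right
  unfold giantTwo localTwo
  omega

/-- `b• + a• = 𝐛• = dim K(ω)` (Theorem 14 eq. (1) for the dual complex). [cite: DuncanSchweinhart2025, Thm. 14 eq. (1)] -/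
theorem dualGiant_add_dualLocal (ω : Finset (Plaquette d L)) :
    dualGiant F ω + dualLocal F ω = finrank F (dualTopCycles F ω) := by
  have h := Submodule.finrank_sup_add_finrank_inf_eq (dualTopCycles F ω) (cobTwo (d := d) (L := L) F)
  have hle : finrank F ↥(cobTwo (d := d) (L := L) F) ≤
      finrank F ↥(dualTopCycles F ω ⊔ cobTwo (d := d) (L := L) F) :=
    Submodule.finrank_mono le_sup_right
  unfold dualGiant dualLocal
  omega

/-- The annihilator of `range(π_{ωᶜ} ∂₃)` in `F^{ωᶜ}` (dot product). [cite: DuncanSchweinhart2025, §2.4 (duality of chains and cochains)] -/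
def dualRangeOrth (ω : Finset (Plaquette d L)) : Submodule F (↥(ωᶜ : Finset (Plaquette d L)) → F) :=
  (LinearMap.range (restrictTo F ωᶜ ∘ₗ bd₃Lin (d := d) (L := L) F)).dualAnnihilator.comap
    (dotProductEquiv F ↥(ωᶜ : Finset (Plaquette d L))).toLinearMap

/-- Membership in the annihilator. [cite: DuncanSchweinhart2025, §2.4] -/
theorem mem_dualRangeOrth {ω : Finset (Plaquette d L)} {c : ↥(ωᶜ : Finset (Plaquette d L)) → F} :
    c ∈ dualRangeOrth F ω ↔
      ∀ w : Cell₃ d L → F, dotProduct c (restrictTo F ωᶜ (bd₃ w)) = 0 := by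
  unfold dualRangeOrth
  rw [Submodule.mem_comap, Submodule.mem_dualAnnihilator]
  constructor
  · intro h w
    have := h _ (LinearMap.mem_range_self _ w)
    simpa using this
  · intro h v hv
    obtain ⟨w, rfl⟩ := LinearMap.mem_range.mp hv
    simpa using h w

/-- `dim (range π_{ωᶜ}∂₃)^⊥ = |ωᶜ| - r•(ω)`. [cite: DuncanSchweinhart2025, §2.4] -/
theorem finrank_dualRangeOrth_add (ω : Finset (Plaquette d L)) :
    finrank F (dualRangeOrth F ω) + dualRank F ω = ωᶜ.card := by
  have h1 := Subspace.finrank_add_finrank_dualAnnihilator_eq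
    (LinearMap.range (restrictTo F ωᶜ ∘ₗ bd₃Lin (d := d) (L := L) F))
  have h3 : finrank F (dualRangeOrth F ω) =
      finrank F (LinearMap.range (restrictTo F ωᶜ ∘ₗ bd₃Lin (d := d) (L := L) F)).dualAnnihilator := by
    unfold dualRangeOrth
    exact (Submodule.comap_equiv_eq_map_symm (dotProductEquiv F ↥(ωᶜ : Finset (Plaquette d L)))
      (LinearMap.range (restrictTo F ωᶜ ∘ₗ bd₃Lin (d := d) (L := L) F)).dualAnnihilator) ▸
      LinearEquiv.finrank_map_eq _ _
  rw [Module.finrank_fintype_fun_eq_card, Fintype.card_coe] at h1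
  unfold dualRank
  omega

/-- For `ξ` supported on `ωᶜ`: `δ₂ξ = 0` iff `ξ|_{ωᶜ}` is orthogonal to `range(π_{ωᶜ}∂₃)` (`δ₂ = ∂₃ᵀ`).
[cite: DuncanSchweinhart2025, §2.4] -/
theorem delta₂_eq_zero_iff_restrict_mem {ω : Finset (Plaquette d L)} {ξ : Plaquette d L → F}
    (hξ : ∀ σ, σ ∈ ω → ξ σ = 0) :
    delta₂ (d := d) (L := L) F ξ = 0 ↔
      (fun σ : ↥(ωᶜ : Finset (Plaquette d L)) => ξ σ.1) ∈ dualRangeOrth F ω := by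
  rw [delta₂_eq_zero_iff_pairing, mem_dualRangeOrth]
  have hsum : ∀ w : Cell₃ d L → F,
      dotProduct (fun σ : ↥(ωᶜ : Finset (Plaquette d L)) => ξ σ.1) (restrictTo F ωᶜ (bd₃ w)) =
        pairing₂ ξ (bd₃ w) := by
    intro w
    unfold dotProduct pairing₂
    simp only [restrictTo, LinearMap.coe_mk, AddHom.coe_mk]
    rw [show (∑ σ : ↥(ωᶜ : Finset (Plaquette d L)), ξ σ.1 * bd₃ w σ.1) =
        ∑ σ ∈ (ωᶜ : Finset (Plaquette d L)), ξ σ * bd₃ w σ from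
      Finset.sum_coe_sort (ωᶜ : Finset (Plaquette d L)) (fun σ => ξ σ * bd₃ w σ)]
    rw [Finset.sum_subset (Finset.subset_univ (ωᶜ : Finset (Plaquette d L)))]
    intro σ _ hσ
    rw [hξ σ (by simpa using hσ), zero_mul]
  simp_rw [hsum]

/-- `K(ω) ≃ (range π_{ωᶜ}∂₃)^⊥` by restriction to the closed plaquettes. [cite: DuncanSchweinhart2025, §2.4 (H_i ≅ H^i over a field)] -/
noncomputable def dualTopCyclesEquiv (ω : Finset (Plaquette d L)) :
    dualTopCycles F ω ≃ₗ[F] dualRangeOrth F ω := by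
  classical
  exact
  { toFun := fun z => ⟨fun σ => z.1 σ.1,
      (delta₂_eq_zero_iff_restrict_mem F ((mem_dualTopCycles F).mp z.2).1).mp
        ((mem_dualTopCycles F).mp z.2).2⟩
    map_add' := fun a b => by ext σ; rfl
    map_smul' := fun r a => by ext σ; rfl
    invFun := fun c =>
      have hsupp : ∀ σ, σ ∈ ω →
          (fun τ => if h : τ ∈ (ωᶜ : Finset (Plaquette d L)) then c.1 ⟨τ, h⟩ else (0 : F)) σ = 0 :=
        fun σ hσ => by simp [hσ]
      ⟨fun σ => if h : σ ∈ (ωᶜ : Finset (Plaquette d L)) then c.1 ⟨σ, h⟩ else 0, by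
        rw [mem_dualTopCycles]
        refine ⟨hsupp, ?_⟩
        rw [delta₂_eq_zero_iff_restrict_mem F hsupp]
        have : (fun σ : ↥(ωᶜ : Finset (Plaquette d L)) =>
            (fun τ => if h : τ ∈ (ωᶜ : Finset (Plaquette d L)) then c.1 ⟨τ, h⟩ else (0 : F)) σ.1) = c.1 := by
          funext σ; simp [σ.2]
        rw [this]; exact c.2⟩
    left_inv := fun z => by
      apply Subtype.ext
      funext σ
      by_cases h : σ ∈ (ωᶜ : Finset (Plaquette d L))
      · simp [h]
      · have hω : σ ∈ ω := by simpa using h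
        simp [h, ((mem_dualTopCycles F).mp z.2).1 σ hω]
    right_inv := fun c => by
      apply Subtype.ext
      funext σ
      simp [σ.2] }

/-- **Dual Euler–Poincaré count: `dim K(ω) + r•(ω) = |ωᶜ|`** — the top Betti number of the dual
complex, `𝐛•_{d-2}(P•(ω•)) = η(P•) - rank(δ•)`, computed in primal coordinates through `δ₂ = ∂₃ᵀ`.
[cite: DuncanSchweinhart2025, Prop. 15 (applied to P•) and §2.4] -/
theorem finrank_dualTopCycles_add (ω : Finset (Plaquette d L)) :
    finrank F (dualTopCycles F ω) + dualRank F ω = ωᶜ.card := by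
  rw [(dualTopCyclesEquiv (d := d) (L := L) F ω).finrank_eq]
  exact finrank_dualRangeOrth_add F ω

/-- `𝐛₂(ω) + r(ω) = |ω|` (companion file, restated with `primalRank`). [cite: DuncanSchweinhart2025, Prop. 15] -/
theorem finrank_twoCycles_add_primalRank (ω : Finset (Plaquette d L)) :
    finrank F (twoCycles F ω) + primalRank F ω = ω.card := by
  rw [finrank_twoCycles]
  exact bettiTwo_add_finrank_range F ω

/-- The `2`-cycles of the FULL torus are `twoCycles univ`, and `r(univ) = rank δ₁ = dim B²`.
[cite: DuncanSchweinhart2025, §2.1] -/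
theorem primalRank_univ : primalRank (d := d) (L := L) F Finset.univ = finrank F ↥(cobTwo (d := d) (L := L) F) := by
  unfold primalRank cobTwo
  rw [← restrictTo_comp_delta₁, LinearMap.range_comp]
  have hinj : Function.Injective (restrictTo F (Finset.univ : Finset (Plaquette d L))) := by
    intro f g h
    funext σ
    have := congrFun h ⟨σ, Finset.mem_univ σ⟩
    simpa [restrictTo] using this
  exact (Submodule.equivMapOfInjective _ hinj _).finrank_eq.symm

/-- **Theorem 14, eq. (2) ("Lemma 10"): `b₂(ω) + b•(ω) = dim H₂(𝕋^d_L; F)` for every `ω`** — the giant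
cycles of `P(ω)` and of its dual `P•(ω•)` together fill the homology of the torus, where
`dim H₂(𝕋; F) = dim Z₂(𝕋) - dim B₂(𝕋)` (`Z₂(𝕋) = twoCycles univ`). PROVED by the four rank
identities above. [cite: DuncanSchweinhart2025, Thm. 14 eq. (2)] -/
theorem giantTwo_add_dualGiant (ω : Finset (Plaquette d L)) :
    giantTwo F ω + dualGiant F ω + finrank F ↥(bdTwo (d := d) (L := L) F) =
      finrank F (twoCycles F (Finset.univ : Finset (Plaquette d L))) := by
  classical
  have h1 := giantTwo_add_localTwo F ω
  have h2 := dualGiant_add_dualLocal F ω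
  have h3 := localTwo_add_dualRank F ω
  have h4 := dualLocal_add_primalRank F ω
  have h5 := finrank_dualTopCycles_add F ω
  have h6 := finrank_twoCycles_add_primalRank F ω
  have h7 := finrank_twoCycles_add_primalRank F (Finset.univ : Finset (Plaquette d L))
  have h8 := primalRank_univ (d := d) (L := L) F
  have hc : ω.card + ωᶜ.card = (Finset.univ : Finset (Plaquette d L)).card := by
    rw [Finset.card_compl, Finset.card_univ]
    have := Finset.card_le_univ ω
    omega
  omega

end AlexanderDuality

/-! ### Theorem 18: duality of the balanced weights -/

section Duality

variable (F : Type*) [Field F] [NeZero L]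

/-- The dual plaquette random-cluster weight of `P•(ω•)` with parameter `p'`, in primal coordinates and
normalised by `|Z^{d-3}(P•)|`-type counting: `p'^{η(P•)} (1-p')^{|F|-η(P•)} q^{dim W(ω)}` with
`η(P•) = |ωᶜ|`; it is `q^{dim B^{d-3}(𝕋•)}` (independent of `ω`) times the weight
`p'^{η•}(1-p')^{|F|-η•} q^{𝐛•_{d-3}(P•)}` of Definition 1 for the dual complex.
[cite: DuncanSchweinhart2025, §4.3 Thm. 18 (the (d-i)-dimensional model on P•) with §3 (P•)] -/
noncomputable def dualWeight (p' q : ℝ) (ω : Finset (Plaquette d L)) : ℝ :=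
  p' ^ ωᶜ.card * (1 - p') ^ ω.card * q ^ finrank F (dualCocycles F ω)

/-- The integer bookkeeping of the proof of Theorem 18 (eqs. (1)–(5) combined):
`2𝐛₁(ω) + b•(ω) + 2|ω| + (2 dim C₃ + dim B² + 2 dim B¹) = 2 dim W(ω) + b₂(ω) + (2 dim C¹ + dim B₂ + |F|)`,
with `|F|` the number of plaquettes. [cite: DuncanSchweinhart2025, Thm. 18 (proof, eqs. (1)–(5))] -/
theorem duality_exponent_identity (ω : Finset (Plaquette d L)) :
    2 * bettiOne F ω + dualGiant F ω + 2 * ω.card +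
        (2 * Fintype.card (Cell₃ d L) + finrank F ↥(cobTwo (d := d) (L := L) F) +
          2 * finrank F (gradCochains (d := d) (L := L) F F)) =
      2 * finrank F (dualCocycles F ω) + giantTwo F ω +
        (2 * finrank F (Site d L → Fin d → F) + finrank F ↥(bdTwo (d := d) (L := L) F) +
          (Finset.univ : Finset (Plaquette d L)).card) := by
  classical
  have h1 := giantTwo_add_localTwo F ω
  have h2 := dualGiant_add_dualLocal F ω
  have h3 := localTwo_add_dualRank F ω
  have h4 := dualLocal_add_primalRank F ω
  have h5 := finrank_dualTopCycles_add F ω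
  have h6 := finrank_twoCycles_add_primalRank F ω
  have h7 := finrank_dualCocycles_add F ω
  -- `𝐛₁ + dim B¹ + r = dim C¹` (rank–nullity for `δ_ω`)
  have h8 : bettiOne F ω + finrank F (gradCochains (d := d) (L := L) F F) + primalRank F ω =
      finrank F (Site d L → Fin d → F) := by
    have := LinearMap.finrank_range_add_finrank_ker (coboundaryOn (d := d) (L := L) F ω)
    rw [ker_coboundaryOn] at this
    have h9 := bettiOne_add_finrank_grad F ω
    unfold primalRank
    omega
  have hc : ω.card + ωᶜ.card = (Finset.univ : Finset (Plaquette d L)).card := by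
    rw [Finset.card_compl, Finset.card_univ]
    have := Finset.card_le_univ ω
    omega
  omega

/-- `p* = (1-p)q/((1-p)q + p)` has `p*^{a} (1-p*)^{b} ((1-p)q+p)^{a+b} = ((1-p)q)^a p^b`.
[cite: DuncanSchweinhart2025, §4.3 eq. (7) (pp*/((1-p)(1-p*)) = q)] -/
theorem dualParam_pow_mul (p q : ℝ) (hden : (1 - p) * q + p ≠ 0) (a b : ℕ) :
    dualParam p q ^ a * (1 - dualParam p q) ^ b * ((1 - p) * q + p) ^ (a + b) =
      ((1 - p) * q) ^ a * p ^ b := by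
  have h1 : 1 - dualParam p q = p / ((1 - p) * q + p) := by
    unfold dualParam
    field_simp
    ring
  unfold dualParam at h1 ⊢
  rw [h1, div_pow, div_pow, pow_add]
  field_simp

/-- **Theorem 18 (Duncan–Schweinhart, duality of the balanced plaquette random-cluster model),
`i = 2`, every `d`, every coefficient field, PROVED in the Alexander-dual dictionary.** For
`p ∈ (0,1)` and `q > 0` there is a constant `C = C(p, q, d, L) > 0` such that for EVERY plaquette
configuration `ω` of `𝕋^d_L`:
`w_{p,q}(ω) · (√q)^{b•(ω)} = C · w•_{p*,q}(ω) · (√q)^{b₂(ω)}`, i.e.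
`(√q)^{-b₂(ω)} w_{p,q}(ω) ∝ (√q)^{-b•(ω)} w•_{p*,q}(ω)`: the balanced weight
`μ̃_{𝕋,p,q,2}(ω) ∝ (√q)^{-b₂} p^{|ω|}(1-p)^{|ωᶜ|} q^{𝐛₁}` of `ω` equals, up to normalisation, the
balanced dual weight `μ̃_{𝕋•,p*,q,d-2}(ω•) ∝ (√q)^{-b•} (p*)^{|ωᶜ|}(1-p*)^{|ω|} q^{𝐛•_{d-3}}` of the
dual configuration `ω• =` duals of the closed plaquettes, `p* = (1-p)q/((1-p)q+p)` (`dualParam`).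
Since both sides are then probability weights of the same total mass after normalisation, this is
`μ̃_{𝕋,p,q,i}(P) =_d μ̃_{𝕋,p*,q,d-i}(P•)` for `i = 2`. Ingredients, as printed: eq. (4)
`η + η• = |F|`, eq. (5) (Prop. 15, `PlaquetteRandomClusterEulerPoincare`), eq. (7), and Theorem 14
(`localTwo_add_dualRank`, `dualLocal_add_primalRank`, `giantTwo_add_dualGiant`).
[cite: DuncanSchweinhart2025, Thm. 18] -/
theorem duality_balanced_weight {p q : ℝ} (hp : p ∈ Set.Ioo (0 : ℝ) 1) (hq : 0 < q) :
    ∃ C : ℝ, 0 < C ∧ ∀ ω : Finset (Plaquette d L),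
      weight F p q ω * Real.sqrt q ^ dualGiant F ω =
        C * (dualWeight F (dualParam p q) q ω * Real.sqrt q ^ giantTwo F ω) := by
  classical
  -- constants
  set s : ℝ := Real.sqrt q with hs
  have hs0 : 0 < s := Real.sqrt_pos.mpr hq
  have hsq : s ^ 2 = q := by rw [hs, Real.sq_sqrt hq.le]
  set N : ℕ := (Finset.univ : Finset (Plaquette d L)).card with hN
  set c₁ : ℕ := 2 * Fintype.card (Cell₃ d L) + finrank F ↥(cobTwo (d := d) (L := L) F) +
    2 * finrank F (gradCochains (d := d) (L := L) F F) with hc₁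
  set c₂ : ℕ := 2 * finrank F (Site d L → Fin d → F) + finrank F ↥(bdTwo (d := d) (L := L) F) + N with hc₂
  set D : ℝ := (1 - p) * q + p with hD
  have h1p : 0 < 1 - p := sub_pos.mpr hp.2
  have hD0 : 0 < D := by rw [hD]; exact add_pos (mul_pos h1p hq) hp.1
  refine ⟨D ^ N * s ^ c₂ / s ^ (2 * N + c₁),
    div_pos (mul_pos (pow_pos hD0 N) (pow_pos hs0 c₂)) (pow_pos hs0 _), fun ω => ?_⟩
  have hexp := duality_exponent_identity (d := d) (L := L) F ω
  have hcard : ω.card + ωᶜ.card = N := by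
    rw [hN, Finset.card_compl, Finset.card_univ]
    have := Finset.card_le_univ ω
    omega
  -- abbreviations for the ω-dependent exponents
  set k := ω.card with hk
  set kc := ωᶜ.card with hkc
  set B1 := bettiOne F ω with hB1
  set W := finrank F (dualCocycles F ω) with hW
  set g := giantTwo F ω with hg
  set gd := dualGiant F ω with hgd
  -- rewrite `q`-powers as `s`-powers
  have hqpow : ∀ n : ℕ, q ^ n = s ^ (2 * n) := fun n => by rw [pow_mul, hsq]
  have hD' : dualParam p q ^ kc * (1 - dualParam p q) ^ k * D ^ N = ((1 - p) * q) ^ kc * p ^ k := by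
    rw [hD, ← hcard, Nat.add_comm k kc]
    exact dualParam_pow_mul p q hD0.ne' kc k
  -- the identity to prove, cleared of denominators
  have hsN : s ^ (2 * N + c₁) ≠ 0 := pow_ne_zero _ hs0.ne'
  rw [div_mul_eq_mul_div, eq_div_iff hsN]
  unfold weight dualWeight
  rw [← hk, ← hkc, ← hB1, ← hW]
  -- both sides as monomials in `p`, `1-p`, `s`
  have lhs : p ^ k * (1 - p) ^ kc * q ^ B1 * s ^ gd * s ^ (2 * N + c₁) =
      p ^ k * (1 - p) ^ kc * s ^ (2 * B1 + gd + 2 * N + c₁) := by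
    rw [hqpow B1]; ring
  have rhs : D ^ N * s ^ c₂ * (dualParam p q ^ kc * (1 - dualParam p q) ^ k * q ^ W * s ^ g) =
      p ^ k * (1 - p) ^ kc * s ^ (2 * W + g + 2 * kc + c₂) := by
    have e1 : D ^ N * s ^ c₂ * (dualParam p q ^ kc * (1 - dualParam p q) ^ k * q ^ W * s ^ g) =
        (dualParam p q ^ kc * (1 - dualParam p q) ^ k * D ^ N) * (q ^ W * s ^ g * s ^ c₂) := by ring
    rw [e1, hD', mul_pow, hqpow W, hqpow kc]
    ring
  rw [lhs, rhs]
  congr 1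
  -- exponents agree by `duality_exponent_identity`
  have : 2 * B1 + gd + 2 * N + c₁ = 2 * W + g + 2 * kc + c₂ := by
    rw [hB1, hgd, hc₁, hW, hg, hc₂, hkc]
    omega
  rw [this]

end Duality

end PlaquetteRC

end Literature.MathematicalPhysics.QuantumFieldTheory
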